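import Mathlib
import Summits.ValiantsHypothesis.ValiantsHypothesis.Theorems.RigidityForcesSymmetryRankRigidMinimalReprLaplaceFourDefs
import Summits.ValiantsHypothesis.ValiantsHypothesis.Theorems.RigidityForcesSymmetryRankRigidMinimalReprLaplaceFourContraction
import Summits.ValiantsHypothesis.ValiantsHypothesis.Theorems.RigidityForcesSymmetryRankRigidMinimalReprLaplaceFourEasy
import Summits.ValiantsHypothesis.ValiantsHypothesis.Theorems.RigidityForcesSymmetryRankRigidMinimalReprLaplaceFourGeneric
import Summits.ValiantsHypothesis.ValiantsHypothesis.Theorems.RigidityForcesSymmetryRankRigidMinimalReprLaplaceFourLineE3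
import Summits.ValiantsHypothesis.ValiantsHypothesis.Theorems.RigidityForcesSymmetryRankRigidMinimalReprLaplaceFourPencilPlanes

/-!
# The profile `(2,2,1)`: the kernel plane of the noise lies in the determinant cone
# (crux `RankRigidMinimalRepr`, stmt-ValiantsHypothesis-18034, route `RigidityForcesSymmetry`)

For a decomposition `P₄ = Σ_{t<2} g_t(v₀,v₁)h_t(v₂,v₃) + Σ_{k<2} b_k(v₀,v₂)b′_k(v₁,v₃) + c(v₀,v₃)c′(v₁,v₂)`
(profile `(2,2,1)`), the contraction `Q(ψ,φ)` is a sum of THREE rank-one matrices whenever `ψ ⊥ g₀φ, g₁φ`; hence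
`det Q(ψ,φ) = 0` there (`det_zero_of_kernel`).  With `det Q(ψ,φ) = 4·Ĝ(ψ,φ)` (`det_Qgen`) and the torus scaling
`Ĝ(ψ,φ) = (Πφ)² F(ψ/φ)`, the `2`-plane `{ψ ⊥ g₀φ, g₁φ}/φ` lies in `{F = 0}`, and `pencil_planes` types it
(`kernel_plane_type`): for every `φ ∈ (ℂˣ)⁴` there are canonical `x, y` (types III / II / I) with `x∘φ, y∘φ ⊥ g_tφ`.

HONEST FRAMING: a step toward `LaplaceOptimal 4` (rung `TiedTorusBound 3`); the crux stays OPEN; nothing on `VP ≠ VNP`.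
-/

set_option autoImplicit false

-- the mandated summit-side namespace repeats a component by design (single-problem summit)
set_option linter.dupNamespace false

namespace Summit.ValiantsHypothesis.ValiantsHypothesis.Theorems.RigidityForcesSymmetryRankRigidMinimalRepr

namespace LaplaceFourLine

open Matrix LaplaceFourContraction LaplaceFourGeneric LaplaceFourEasy

/-! ### §1 The determinant of the contraction -/

/-- `det Q(ψ,φ) = 4·(4 e₄(ψ)e₄(φ) - (Σ_i ψ_i Π_{j≠i} φ_j)(Σ_i φ_i Π_{j≠i} ψ_j))`. -/
theorem det_Qgen {R : Type*} [CommRing R] (ψ φ : Fin 4 → R) :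
    (Qgen ψ φ).det = 4 * (4 * (ψ 0 * ψ 1 * ψ 2 * ψ 3) * (φ 0 * φ 1 * φ 2 * φ 3) -
      (ψ 0 * φ 1 * φ 2 * φ 3 + ψ 1 * φ 0 * φ 2 * φ 3 + ψ 2 * φ 0 * φ 1 * φ 3 + ψ 3 * φ 0 * φ 1 * φ 2) *
      (φ 0 * ψ 1 * ψ 2 * ψ 3 + φ 1 * ψ 0 * ψ 2 * ψ 3 + φ 2 * ψ 0 * ψ 1 * ψ 3 + φ 3 * ψ 0 * ψ 1 * ψ 2)) := by
  rw [Matrix.det_succ_row_zero]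
  simp [Fin.sum_univ_succ, Matrix.det_fin_three, Qgen, Matrix.submatrix, Fin.succAbove]
  ring

/-- A sum of three rank-one `4 × 4` matrices is singular. -/
theorem det_three_rank_one (x₀ x₁ x₂ y₀ y₁ y₂ : Fin 4 → ℂ) :
    (vecMulVec x₀ y₀ + vecMulVec x₁ y₁ + vecMulVec x₂ y₂).det = 0 := by
  classical
  obtain ⟨n, hn, hAn⟩ := exists_ne_zero_of_three_conditions (Matrix.of ![y₀, y₁, y₂])
  have h0 : y₀ ⬝ᵥ n = 0 := by simpa [Matrix.mulVec, Matrix.of_apply] using congrFun hAn 0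
  have h1 : y₁ ⬝ᵥ n = 0 := by simpa [Matrix.mulVec, Matrix.of_apply] using congrFun hAn 1
  have h2 : y₂ ⬝ᵥ n = 0 := by simpa [Matrix.mulVec, Matrix.of_apply] using congrFun hAn 2
  rw [← Matrix.exists_mulVec_eq_zero_iff]
  refine ⟨n, hn, ?_⟩
  rw [Matrix.add_mulVec, Matrix.add_mulVec, vecMulVec_mulVec, vecMulVec_mulVec, vecMulVec_mulVec, h0, h1, h2]
  simp

/-! ### §2 The kernel of the noise makes the contraction singular -/

/-- For a `(2,2,1)` decomposition: if `ψ ⊥ g₀φ, g₁φ` then `Q(ψ,φ)` is a sum of three rank-one matrices and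
`det Q(ψ,φ) = 0`. -/
theorem det_zero_of_kernel (g h b b' : Fin 2 → Fin 4 → Fin 4 → ℂ) (c c' : Fin 4 → Fin 4 → ℂ)
    (hsum : ∀ v, permPattern₄ v = (∑ t, g t (v 0) (v 1) * h t (v 2) (v 3)) +
      (∑ k, b k (v 0) (v 2) * b' k (v 1) (v 3)) + c (v 0) (v 3) * c' (v 1) (v 2))
    (ψ φ : Fin 4 → ℂ) (hψ : ∀ t, (∑ i, ∑ j, ψ i * φ j * g t i j) = 0) : (Qgen ψ φ).det = 0 := by
  have hQ : contract₀₁ permPattern₄ ψ φ = (∑ t, (∑ x, ∑ y, ψ x * φ y * g t x y) • Matrix.of (h t)) +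
      (vecMulVec (fun i => ∑ z, ψ z * b 0 z i) (fun j => ∑ w, φ w * b' 0 w j) +
        vecMulVec (fun i => ∑ z, ψ z * b 1 z i) (fun j => ∑ w, φ w * b' 1 w j)) +
        vecMulVec (fun i => ∑ w, φ w * c' w i) (fun j => ∑ z, ψ z * c z j) := by
    rw [contract_congr hsum]
    have hsplit : (fun v => (∑ t, g t (v 0) (v 1) * h t (v 2) (v 3)) + (∑ k, b k (v 0) (v 2) * b' k (v 1) (v 3)) +
        c (v 0) (v 3) * c' (v 1) (v 2)) = fun v => ∑ k : Fin 3, (![fun v => ∑ t, g t (v 0) (v 1) * h t (v 2) (v 3),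
        fun v => ∑ k, b k (v 0) (v 2) * b' k (v 1) (v 3), fun v => c (v 0) (v 3) * c' (v 1) (v 2)] :
          Fin 3 → (Fin 4 → Fin 4) → ℂ) k v := by
      funext v; simp [Fin.sum_univ_three]
    rw [contract_congr (fun v => congrFun hsplit v), contract_sum, Fin.sum_univ_three]
    simp only [Matrix.cons_val_zero, Matrix.cons_val_one, Matrix.cons_val_two, Matrix.tail_cons, Matrix.head_cons]
    rw [contract_sum Finset.univ (fun t v => g t (v 0) (v 1) * h t (v 2) (v 3)),
      contract_sum Finset.univ (fun k v => b k (v 0) (v 2) * b' k (v 1) (v 3)), contract_pair03]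
    congr 1; congr 1
    · exact Finset.sum_congr rfl fun t _ => contract_pair01 _ _ ψ φ
    · rw [Fin.sum_univ_two, contract_pair02, contract_pair02]
  have hnoise : (∑ t, (∑ x, ∑ y, ψ x * φ y * g t x y) • Matrix.of (h t)) = 0 :=
    Finset.sum_eq_zero fun t _ => by rw [hψ t, zero_smul]
  rw [Qgen_eq_contract, hQ, hnoise, zero_add]
  exact det_three_rank_one _ _ _ _ _ _

/-! ### §3 The kernel plane is one of the sixteen planes -/

/-- **Type of the kernel plane.**  For a `(2,2,1)` decomposition and every `φ ∈ (ℂˣ)⁴` there are canonical vectors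
`x, y` — `(e_c, e_d)` (III), `(e_a + e_b, e_c - e_d)` (II) or `(e_b - e_d, e_c - e_d)` (I) — with `x∘φ, y∘φ ⊥ g_tφ`
(`t = 0, 1`), i.e. `Σ_i x_i φ_i (g_tφ)_i = 0`. -/
theorem kernel_plane_type (g h b b' : Fin 2 → Fin 4 → Fin 4 → ℂ) (c c' : Fin 4 → Fin 4 → ℂ)
    (hsum : ∀ v, permPattern₄ v = (∑ t, g t (v 0) (v 1) * h t (v 2) (v 3)) +
      (∑ k, b k (v 0) (v 2) * b' k (v 1) (v 3)) + c (v 0) (v 3) * c' (v 1) (v 2))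
    (φ : Fin 4 → ℂ) (hφ : ∀ i, φ i ≠ 0) :
    ∃ x y : Fin 4 → ℂ, (∀ t, (∑ i, ∑ j, (x i * φ i) * φ j * g t i j) = 0) ∧
      (∀ t, (∑ i, ∑ j, (y i * φ i) * φ j * g t i j) = 0) ∧
      ((∃ c d : Fin 4, c ≠ d ∧ x = Pi.single c 1 ∧ y = Pi.single d 1) ∨
       (∃ a b c d : Fin 4, [a, b, c, d].Nodup ∧ x = Pi.single a 1 + Pi.single b 1 ∧
          y = Pi.single c 1 - Pi.single d 1) ∨
       (∃ a b c d : Fin 4, [a, b, c, d].Nodup ∧ x = Pi.single b 1 - Pi.single d 1 ∧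
          y = Pi.single c 1 - Pi.single d 1)) := by
  classical
  -- two independent vectors in the kernel of the two forms `ψ ↦ ψᵀ g_t φ`
  obtain ⟨ψ₁, ψ₂, hind, h₁, h₂⟩ := exists_indep_pair_of_two_conditions
    (Matrix.of fun (t : Fin 2) (i : Fin 4) => ∑ j, φ j * g t i j)
  have hker : ∀ (s u : ℂ) (t : Fin 2), (∑ i, ∑ j, (s * ψ₁ i + u * ψ₂ i) * φ j * g t i j) = 0 := by
    intro s u t
    have e1 : (∑ i, (∑ j, φ j * g t i j) * ψ₁ i) = 0 := by
      simpa [Matrix.mulVec, dotProduct, Matrix.of_apply] using congrFun h₁ t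
    have e2 : (∑ i, (∑ j, φ j * g t i j) * ψ₂ i) = 0 := by
      simpa [Matrix.mulVec, dotProduct, Matrix.of_apply] using congrFun h₂ t
    have : (∑ i, ∑ j, (s * ψ₁ i + u * ψ₂ i) * φ j * g t i j) =
        s * (∑ i, (∑ j, φ j * g t i j) * ψ₁ i) + u * ∑ i, (∑ j, φ j * g t i j) * ψ₂ i := by
      rw [Finset.mul_sum, Finset.mul_sum, ← Finset.sum_add_distrib]
      refine Finset.sum_congr rfl fun i _ => ?_
      rw [Finset.sum_mul, Finset.sum_mul, Finset.mul_sum, Finset.mul_sum, ← Finset.sum_add_distrib]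
      exact Finset.sum_congr rfl fun j _ => by ring
    rw [this, e1, e2]; ring
  -- in `t`-coordinates: `p = ψ₁/φ`, `q = ψ₂/φ`
  set p : Fin 4 → ℂ := fun i => ψ₁ i / φ i with hp
  set q : Fin 4 → ℂ := fun i => ψ₂ i / φ i with hq
  have hpφ : ∀ i, p i * φ i = ψ₁ i := fun i => by have := hφ i; rw [hp]; field_simp
  have hqφ : ∀ i, q i * φ i = ψ₂ i := fun i => by have := hφ i; rw [hq]; field_simp
  have hind' : ∀ α β : ℂ, α • p + β • q = 0 → α = 0 ∧ β = 0 := by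
    intro α β h0
    refine LinearIndependent.pair_iff.1 hind α β (funext fun i => ?_)
    have := congrFun h0 i
    simp only [Pi.add_apply, Pi.smul_apply, smul_eq_mul, Pi.zero_apply] at this ⊢
    rw [← hpφ i, ← hqφ i]
    linear_combination φ i * this
  -- the quartic vanishes on `span(p,q)`
  have hF : ∀ s u : ℂ, (fun t : Fin 4 → ℂ => 4 * (t 0 * t 1 * t 2 * t 3) -
      (t 0 + t 1 + t 2 + t 3) * (t 1 * t 2 * t 3 + t 0 * t 2 * t 3 + t 0 * t 1 * t 3 + t 0 * t 1 * t 2)) (s • p + u • q)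
      = 0 := by
    intro s u
    have hdet := det_zero_of_kernel g h b b' c c' hsum (s • ψ₁ + u • ψ₂) φ
      (fun t => by simpa only [Pi.add_apply, Pi.smul_apply, smul_eq_mul] using hker s u t)
    rw [det_Qgen] at hdet
    simp only [Pi.add_apply, Pi.smul_apply, smul_eq_mul, ← hpφ, ← hqφ] at hdet ⊢
    have hπ : (φ 0 * φ 1 * φ 2 * φ 3) ^ 2 ≠ 0 :=
      pow_ne_zero 2 (mul_ne_zero (mul_ne_zero (mul_ne_zero (hφ 0) (hφ 1)) (hφ 2)) (hφ 3))
    have key : (φ 0 * φ 1 * φ 2 * φ 3) ^ 2 *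
        (4 * ((s * p 0 + u * q 0) * (s * p 1 + u * q 1) * (s * p 2 + u * q 2) * (s * p 3 + u * q 3)) -
        (s * p 0 + u * q 0 + (s * p 1 + u * q 1) + (s * p 2 + u * q 2) + (s * p 3 + u * q 3)) *
        ((s * p 1 + u * q 1) * (s * p 2 + u * q 2) * (s * p 3 + u * q 3) +
          (s * p 0 + u * q 0) * (s * p 2 + u * q 2) * (s * p 3 + u * q 3) +
          (s * p 0 + u * q 0) * (s * p 1 + u * q 1) * (s * p 3 + u * q 3) +
          (s * p 0 + u * q 0) * (s * p 1 + u * q 1) * (s * p 2 + u * q 2))) = 0 := by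
      linear_combination hdet / 4
    exact (mul_eq_zero.1 key).resolve_left hπ
  obtain ⟨x, y, ⟨α, β, hx⟩, ⟨α', β', hy⟩, hcanon⟩ := pencil_planes _ (fun _ => rfl) p q hind' hF
  have e : ∀ (α β : ℂ) (i : Fin 4), (α • p + β • q) i * φ i = α * ψ₁ i + β * ψ₂ i := by
    intro α β i
    simp only [Pi.add_apply, Pi.smul_apply, smul_eq_mul]
    rw [← hpφ i, ← hqφ i]; ring
  refine ⟨x, y, fun t => ?_, fun t => ?_, hcanon⟩
  · rw [hx]; simp_rw [e]; exact hker α β t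
  · rw [hy]; simp_rw [e]; exact hker α' β' t

end LaplaceFourLine

end Summit.ValiantsHypothesis.ValiantsHypothesis.Theorems.RigidityForcesSymmetryRankRigidMinimalRepr
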